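import Summits.Ventures.PackingBounds.Energy.FivePointCkTwoGramOne
import Summits.Ventures.PackingBounds.Energy.FivePointCkTwoGramG1
import Summits.Ventures.PackingBounds.Energy.FivePointCkTwoGramG2
import Summits.Ventures.PackingBounds.Energy.FivePointCkTwoGramG3
import Summits.Ventures.PackingBounds.Energy.FivePointCkTwoGramS2
import Summits.Ventures.PackingBounds.Energy.FivePointCkTwoGramS4
import HarnessLib

/-!
# `FivePointCkTwo`: the slack of the three-point inequality is `Σ_i m_i · (Gram form)` and nonnegative on the domain

Framing: lottery ticket; floor = certified bounds/negative ranges. Venture `PackingBounds`, cell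
`pub-packcert`, energy family E3PT (pub-packcert-energy gen 11).
-/

noncomputable section

namespace Summit.Ventures.PackingBounds.Energy.FivePointCkTwo

set_option maxRecDepth 20000 in
set_option maxHeartbeats 400000000 in
/-- The slack of the three-point inequality equals `Σ_i m_i(u,v,t) · w_i(u,v,t)ᵀ Y_i w_i(u,v,t)` (`ring`). -/
theorem rexp_eqQ2 (u v t : ℝ) :
    (pminKQ2 u + pminKQ2 v + pminKQ2 t) / 3 - (c0KQ2 + 3 * FexpKQ2 u v t + FexpKQ2 u u 1 + FexpKQ2 v v 1 + FexpKQ2 t t 1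
      + (a1KQ2 * u + a1KQ2 * v + a1KQ2 * t) / 3)
      = quad_1Q2 (wv_1Q2 u v t) + (1 - u ^ 2) * quad_g1Q2 (wv_g1Q2 u v t) + (1 - v ^ 2) * quad_g2Q2 (wv_g2Q2 u v t) + (1 - t ^ 2) * quad_g3Q2 (wv_g3Q2 u v t) + ((1 - u ^ 2) * (1 - v ^ 2) + (1 - u ^ 2) * (1 - t ^ 2) + (1 - v ^ 2) * (1 - t ^ 2)) * quad_s2Q2 (wv_s2Q2 u v t) + (1 + 2 * u * v * t - u ^ 2 - v ^ 2 - t ^ 2) * quad_s4Q2 (wv_s4Q2 u v t) := by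
  unfold pminKQ2 FexpKQ2 c0KQ2 a1KQ2 quad_1Q2 quad_g1Q2 quad_g2Q2 quad_g3Q2 quad_s2Q2 quad_s4Q2 quad_1_0Q2 quad_1_1Q2 quad_g1_0Q2 quad_g2_0Q2 quad_g3_0Q2 quad_s2_0Q2 quad_s4_0Q2
  simp only [wv_1Q2, wv_g1Q2, wv_g2Q2, wv_g3Q2, wv_s2Q2, wv_s4Q2]
  ring

/-- The slack polynomial is nonnegative on the domain `D` (each multiplier `≥ 0` on `D`, each Gram block PSD). -/
theorem slack_nonnegQ2 (u v t : ℝ) (hu1 : -1 ≤ u) (hu2 : u ≤ 1) (hv1 : -1 ≤ v) (hv2 : v ≤ 1) (ht1 : -1 ≤ t) (ht2 : t ≤ 1)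
    (hdet : 0 ≤ 1 + 2 * u * v * t - u ^ 2 - v ^ 2 - t ^ 2) :
    0 ≤ (pminKQ2 u + pminKQ2 v + pminKQ2 t) / 3 - (c0KQ2 + 3 * FexpKQ2 u v t + FexpKQ2 u u 1 + FexpKQ2 v v 1 + FexpKQ2 t t 1
      + (a1KQ2 * u + a1KQ2 * v + a1KQ2 * t) / 3) := by
  rw [rexp_eqQ2]
  have mu1 : 0 ≤ 1 - u ^ 2 := by nlinarith
  have mv1 : 0 ≤ 1 - v ^ 2 := by nlinarith
  have mt1 : 0 ≤ 1 - t ^ 2 := by nlinarith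
  exact (add_nonneg (add_nonneg (add_nonneg (add_nonneg (add_nonneg (quad_1_nonnegQ2 (wv_1Q2 u v t)) (mul_nonneg mu1 (quad_g1_nonnegQ2 (wv_g1Q2 u v t)))) (mul_nonneg mv1 (quad_g2_nonnegQ2 (wv_g2Q2 u v t)))) (mul_nonneg mt1 (quad_g3_nonnegQ2 (wv_g3Q2 u v t)))) (mul_nonneg (add_nonneg (add_nonneg (mul_nonneg mu1 mv1) (mul_nonneg mu1 mt1)) (mul_nonneg mv1 mt1)) (quad_s2_nonnegQ2 (wv_s2Q2 u v t)))) (mul_nonneg hdet (quad_s4_nonnegQ2 (wv_s4Q2 u v t))))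

end Summit.Ventures.PackingBounds.Energy.FivePointCkTwo
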